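import Literature.Topology.PlaneTopology.Janiszewski
import Literature.Topology.PlaneTopology.BandCrossing
import Literature.Topology.PlaneTopology.RectangleDuality
import Mathlib.Analysis.Normed.Module.Connected
import Mathlib.LinearAlgebra.Complex.FiniteDimensional
import HarnessLib

/-!
# The membrane lemma: the common frontier region of two open sets spans an annulus

M. Hochman, *Irreducibility and periodicity in `ℤ²` symbolic systems* (Discrete Analysis
2025:17), §6.2–6.3, works with two disjoint open "zones" `Ê_x, Ê_y ⊆ ℝ²` and the closed *gap*
`Ê = ℝ² ∖ (Ê_x ∪ Ê_y)` separating them, and uses without proof (Step C, p. 33: "Since `n < n₀`,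
the diameter of `Ê` is at least `rₙ/10` ... this implies that `Ê ∩ F` has a connected component
`Ê'` with diameter at least `rₙ/10`") that the gap has large connected pieces wherever both zones
are substantial. This file proves the planar statement that makes this rigorous:

* `Hochman2025.exists_continuum_compl_annulus` (**membrane lemma**): let `U, V ⊆ ℂ` be disjoint
  open sets and `0 < r₀ < r₁`; if each of `U` and `V` contains a preconnected set reaching from the
  open disc `B(e, r₀)` to outside the closed disc `B̄(e, r₁)`, then the closed set `(U ∪ V)ᶜ`
  contains a compact connected subset of the annulus `r₀ ≤ |z - e| ≤ r₁` meeting both of its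
  boundary circles.

Proof: otherwise the cut-wire theorem (`exists_closed_separation`) splits
`Z = (U ∪ V)ᶜ ∩ annulus = Z₁ ⊔ Z₂` with `Z₁` off the outer circle and `Z₂` off the inner one.
Put `A = Z₁ ∪ B̄(e, r₀)` and `B = Z₂ ∪ {r₁ ≤ |z - e| ≤ 3r₁}`; these are disjoint compact sets.
Joining the two ends of each given preconnected set by a path in the open set and stopping at the
first exit from a disc `B(e, ρ')` with `max |Z₁ - e| < ρ' < r₁` gives points `x ∈ U`, `y ∈ V` on
the circle `|z - e| = ρ'`, which is connected and misses `A`; the two initial path segments and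
the small disc form a connected set missing `B`; so by **Janiszewski's theorem**
(`Literature.Topology.PlaneTopology.janiszewski`) `x, y` are not separated by `A ∪ B`. But a
connected set containing `x` and missing `A ∪ B` stays inside the annulus (it cannot cross the
shell) and off `(U ∪ V)ᶜ`, hence inside `U` — and `y ∈ V`.

## References

* [Hochman2025] M. Hochman, op. cit., §6.3 Step C (p. 33).
* [PommerenkeBBCM1992] Ch. Pommerenke, *Boundary Behaviour of Conformal Maps* (1992), §1.1
  (Janiszewski's theorem) — via the tree's `Janiszewski.lean`.
-/

noncomputable section

open Set Metric

namespace Literature.Dynamics.SymbolicDynamics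

namespace Hochman2025

open Literature.Topology.PlaneTopology

/-- **First exit from a disc.** A continuous `g : ℝ → ℂ` with `|g 0 - e| < ρ ≤ |g 1 - e|` has a
first parameter `τ ∈ (0, 1]` with `|g τ - e| = ρ`, before which it stays in the closed disc.
[folklore] -/
theorem exists_first_exit {g : ℝ → ℂ} (hg : Continuous g) {e : ℂ} {ρ : ℝ}
    (h0 : dist (g 0) e < ρ) (h1 : ρ ≤ dist (g 1) e) :
    ∃ τ ∈ Ioc (0 : ℝ) 1, dist (g τ) e = ρ ∧ ∀ t ∈ Icc 0 τ, dist (g t) e ≤ ρ := by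
  set d : ℝ → ℝ := fun t => dist (g t) e with hd
  have hdc : Continuous d := (hg.dist continuous_const)
  set T : Set ℝ := Icc 0 1 ∩ {t | ρ ≤ d t} with hT
  have hTc : IsClosed T := isClosed_Icc.inter (isClosed_le continuous_const hdc)
  have hTne : T.Nonempty := ⟨1, ⟨zero_le_one, le_rfl⟩, h1⟩
  have hTbdd : BddBelow T := ⟨0, fun t ht => ht.1.1⟩
  set τ := sInf T with hτ
  have hτmem : τ ∈ T := hTc.csInf_mem hTne hTbdd
  have hτ1 : τ ≤ 1 := csInf_le hTbdd ⟨⟨zero_le_one, le_rfl⟩, h1⟩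
  have hbefore : ∀ t, 0 ≤ t → t < τ → d t < ρ := by
    intro t ht0 htτ
    by_contra hge
    push Not at hge
    have : τ ≤ t := csInf_le hTbdd ⟨⟨ht0, htτ.le.trans hτ1⟩, hge⟩
    linarith
  have hτpos : 0 < τ := by
    rcases hτmem.1.1.eq_or_lt with h | h
    · exfalso
      have := hτmem.2
      rw [← h] at this
      exact absurd h0 (not_lt.mpr this)
    · exact h
  have hdτ : d τ = ρ := by
    refine le_antisymm ?_ hτmem.2
    -- `d τ ≤ ρ` by continuity from the left
    have hcont : ContinuousWithinAt d (Iio τ) τ := hdc.continuousWithinAt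
    have hmem : τ ∈ closure (Ioo 0 τ) := by
      rw [closure_Ioo hτpos.ne]; exact ⟨hτpos.le, le_rfl⟩
    have hle : ∀ t ∈ Ioo 0 τ, d t ≤ ρ := fun t ht => (hbefore t ht.1.le ht.2).le
    exact ContinuousWithinAt.closure_le (f := d) (g := fun _ => ρ) hmem
      (hdc.continuousWithinAt) continuousWithinAt_const hle
  refine ⟨τ, ⟨hτpos, hτ1⟩, hdτ, fun t ht => ?_⟩
  rcases ht.2.eq_or_lt with h | h
  · rw [h]; exact le_of_eq hdτ
  · exact (hbefore t ht.1 h).le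

/-- **The membrane lemma.** Let `U, V ⊆ ℂ` be disjoint open sets, `e ∈ ℂ`, `0 < r₀ < r₁`, and
suppose each of `U`, `V` contains a preconnected set with a point in the open disc `B(e, r₀)` and
a point outside the closed disc `B̄(e, r₁)`. Then the closed set `(U ∪ V)ᶜ` contains a compact
connected subset of the annulus `r₀ ≤ |z - e| ≤ r₁` meeting both circles `|z - e| = r₀` and
`|z - e| = r₁`. (This supplies the "connected component of the gap of diameter `≥ r/10`" used in
§6.3 Steps C–D.) [cite: Hochman2025, §6.3 Step C (with PommerenkeBBCM1992 §1.1, Janiszewski)] -/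
theorem exists_continuum_compl_annulus {U V : Set ℂ} (hU : IsOpen U) (hV : IsOpen V)
    (hUV : Disjoint U V) {e : ℂ} {r₀ r₁ : ℝ} (hr₀ : 0 < r₀) (hr : r₀ < r₁)
    (hSU : ∃ S ⊆ U, IsPreconnected S ∧ (∃ p ∈ S, dist p e < r₀) ∧ ∃ q ∈ S, r₁ < dist q e)
    (hSV : ∃ S ⊆ V, IsPreconnected S ∧ (∃ p ∈ S, dist p e < r₀) ∧ ∃ q ∈ S, r₁ < dist q e) :
    ∃ P : Set ℂ, P ⊆ (U ∪ V)ᶜ ∧ IsCompact P ∧ IsPreconnected P ∧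
      (∀ p ∈ P, r₀ ≤ dist p e ∧ dist p e ≤ r₁) ∧ (∃ p ∈ P, dist p e = r₀) ∧
        ∃ q ∈ P, dist q e = r₁ := by
  set G : Set ℂ := (U ∪ V)ᶜ with hG
  have hGc : IsClosed G := (hU.union hV).isClosed_compl
  set Ann : Set ℂ := {z | r₀ ≤ dist z e ∧ dist z e ≤ r₁} with hAnn
  have hAnnc : IsClosed Ann :=
    (isClosed_le continuous_const (continuous_id.dist continuous_const)).inter
      (isClosed_le (continuous_id.dist continuous_const) continuous_const)
  set Z : Set ℂ := G ∩ Ann with hZ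
  have hZcpt : IsCompact Z := by
    refine (isCompact_closedBall e r₁).of_isClosed_subset (hGc.inter hAnnc) ?_
    intro z hz; exact mem_closedBall.mpr hz.2.2
  set C₀ : Set ℂ := sphere e r₀ with hC₀
  set C₁ : Set ℂ := sphere e r₁ with hC₁
  -- Either some connected subset of `Z` meets both circles (done), or cut-wire.
  by_cases hex : ∃ C ⊆ Z, IsPreconnected C ∧ (C ∩ C₀).Nonempty ∧ (C ∩ C₁).Nonempty
  · obtain ⟨C, hCZ, hCc, ⟨p, hpC, hp⟩, ⟨q, hqC, hq⟩⟩ := hex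
    have hclZ : closure C ⊆ Z := closure_minimal hCZ (hGc.inter hAnnc)
    refine ⟨closure C, fun z hz => (hclZ hz).1, hZcpt.of_isClosed_subset isClosed_closure hclZ,
      hCc.closure, fun z hz => (hclZ hz).2, ⟨p, subset_closure hpC, ?_⟩, ⟨q, subset_closure hqC, ?_⟩⟩
    · exact mem_sphere.mp hp
    · exact mem_sphere.mp hq
  exfalso
  push Not at hex
  obtain ⟨Z₁, Z₂, hZ₁, hZ₂, hZdisj, hZunion, hZ₁C₁, hZ₂C₀⟩ :=
    exists_closed_separation (A := C₀) (B := C₁) hZcpt isClosed_sphere isClosed_sphere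
      (fun C hC hCc hCA hCB => by
        have h0 := hex C hC hCc hCA
        rw [h0] at hCB
        exact Set.not_nonempty_empty hCB)
  have hZ₁Z : Z₁ ⊆ Z := hZunion ▸ subset_union_left
  have hZ₂Z : Z₂ ⊆ Z := hZunion ▸ subset_union_right
  have hZ₁cpt : IsCompact Z₁ := hZcpt.of_isClosed_subset hZ₁ hZ₁Z
  have hZ₂cpt : IsCompact Z₂ := hZcpt.of_isClosed_subset hZ₂ hZ₂Z
  -- radii: `Z₁ ⊆ {dist ≤ m₁}` with `m₁ < r₁`; `Z₂ ⊆ {dist ≥ m₂}` with `m₂ > r₀`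
  obtain ⟨m₁, hm₁lo, hm₁hi, hZ₁m⟩ : ∃ m₁, r₀ ≤ m₁ ∧ m₁ < r₁ ∧ ∀ z ∈ Z₁, dist z e ≤ m₁ := by
    rcases Z₁.eq_empty_or_nonempty with h | hne
    · exact ⟨r₀, le_rfl, hr, by simp [h]⟩
    · obtain ⟨z₀, hz₀, hmax⟩ := hZ₁cpt.exists_isMaxOn hne (continuous_id.dist continuous_const).continuousOn
      refine ⟨max r₀ (dist z₀ e), le_max_left _ _, max_lt hr ?_, fun z hz => le_trans (hmax hz) (le_max_right _ _)⟩
      have h1 : dist z₀ e ≤ r₁ := (hZ₁Z hz₀).2.2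
      rcases h1.lt_or_eq with h | h
      · exact h
      · exfalso
        exact Set.disjoint_left.mp hZ₁C₁ hz₀ (mem_sphere.mpr h)
  obtain ⟨m₂, hm₂lo, hm₂hi, hZ₂m⟩ : ∃ m₂, r₀ < m₂ ∧ m₂ ≤ r₁ ∧ ∀ z ∈ Z₂, m₂ ≤ dist z e := by
    rcases Z₂.eq_empty_or_nonempty with h | hne
    · exact ⟨r₁, hr, le_rfl, by simp [h]⟩
    · obtain ⟨z₀, hz₀, hmin⟩ := hZ₂cpt.exists_isMinOn hne (continuous_id.dist continuous_const).continuousOn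
      refine ⟨min r₁ (dist z₀ e), lt_min hr ?_, min_le_left _ _, fun z hz => le_trans (min_le_right _ _) (hmin hz)⟩
      have h1 : r₀ ≤ dist z₀ e := (hZ₂Z hz₀).2.1
      rcases h1.lt_or_eq with h | h
      · exact h
      · exfalso
        exact Set.disjoint_left.mp hZ₂C₀ hz₀ (mem_sphere.mpr h.symm)
  set ρ' := (m₁ + r₁) / 2 with hρ'
  have hρ'm : m₁ < ρ' := by rw [hρ']; linarith
  have hρ'r : ρ' < r₁ := by rw [hρ']; linarith
  have hρ'0 : r₀ < ρ' := lt_of_le_of_lt hm₁lo hρ'm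
  set r₀' := (r₀ + m₂) / 2 with hr₀'
  have hr₀'lo : r₀ < r₀' := by rw [hr₀']; linarith
  have hr₀'hi : r₀' < m₂ := by rw [hr₀']; linarith
  -- the two compact sets
  set A_ : Set ℂ := Z₁ ∪ closedBall e r₀ with hA_
  set Sh : Set ℂ := {z | r₁ ≤ dist z e ∧ dist z e ≤ 3 * r₁} with hSh
  set B_ : Set ℂ := Z₂ ∪ Sh with hB_
  have hShc : IsClosed Sh :=
    (isClosed_le continuous_const (continuous_id.dist continuous_const)).inter
      (isClosed_le (continuous_id.dist continuous_const) continuous_const)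
  have hShcpt : IsCompact Sh := by
    refine (isCompact_closedBall e (3 * r₁)).of_isClosed_subset hShc ?_
    intro z hz; exact mem_closedBall.mpr hz.2
  have hAcpt : IsCompact A_ := hZ₁cpt.union (isCompact_closedBall e r₀)
  have hBcpt : IsCompact B_ := hZ₂cpt.union hShcpt
  have hA_rad : ∀ z ∈ A_, dist z e ≤ m₁ := by
    rintro z (hz | hz)
    · exact hZ₁m z hz
    · exact le_trans (mem_closedBall.mp hz) hm₁lo
  have hB_rad : ∀ z ∈ B_, min m₂ r₁ ≤ dist z e := by
    rintro z (hz | hz)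
    · exact le_trans (min_le_left _ _) (hZ₂m z hz)
    · exact le_trans (min_le_right _ _) hz.1
  have hAB : A_ ∩ B_ = ∅ := by
    ext z
    simp only [mem_inter_iff, mem_empty_iff_false, iff_false, not_and]
    intro hzA hzB
    have h1 := hA_rad z hzA
    have h2 := hB_rad z hzB
    have : min m₂ r₁ ≤ m₁ := le_trans h2 h1
    rcases min_choice m₂ r₁ with h | h <;> rw [h] at this
    · -- `m₂ ≤ m₁`: a point of `Z₂` at distance ≤ m₁? only via `z`:
      -- `z ∈ B_`: if `z ∈ Z₂` then `dist ≥ m₂ > r₀` so `z ∉ closedBall`, so `z ∈ Z₁`: disjoint.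
      rcases hzB with hz2 | hzS
      · rcases hzA with hz1 | hzb
        · exact Set.disjoint_left.mp hZdisj hz1 hz2
        · have := hZ₂m z hz2
          have := mem_closedBall.mp hzb
          linarith
      · linarith [hzS.1]
    · linarith
  -- paths in `U` and `V` and their first exits from `B(e, ρ')`
  have hpath : ∀ W : Set ℂ, IsOpen W →
      (∃ S ⊆ W, IsPreconnected S ∧ (∃ p ∈ S, dist p e < r₀) ∧ ∃ q ∈ S, r₁ < dist q e) →
      ∃ g : ℝ → ℂ, Continuous g ∧ (∀ t ∈ Icc (0 : ℝ) 1, g t ∈ W) ∧ dist (g 0) e < r₀ ∧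
        ∃ τ ∈ Ioc (0 : ℝ) 1, dist (g τ) e = ρ' ∧ ∀ t ∈ Icc 0 τ, dist (g t) e ≤ ρ' := by
    intro W hW ⟨S, hSW, hSc, ⟨p, hpS, hp⟩, ⟨q, hqS, hq⟩⟩
    have hj : JoinedIn W p q := joinedIn_of_isPreconnected hW hSc hSW hpS hqS
    set γ := hj.somePath with hγ
    refine ⟨γ.extend, γ.continuous_extend, fun t ht => ?_, by rw [γ.extend_zero]; exact hp, ?_⟩
    · rw [γ.extend_apply ht]; exact hj.somePath_mem _
    · have h1 : ρ' ≤ dist (γ.extend 1) e := by rw [γ.extend_one]; linarith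
      have h0 : dist (γ.extend 0) e < ρ' := by rw [γ.extend_zero]; linarith
      exact exists_first_exit γ.continuous_extend h0 h1
  obtain ⟨gU, hgUc, hgUW, hgU0, τU, hτU, hxU, hgUle⟩ := hpath U hU hSU
  obtain ⟨gV, hgVc, hgVW, hgV0, τV, hτV, hyV, hgVle⟩ := hpath V hV hSV
  set x := gU τU with hx
  set y := gV τV with hy
  have hxUmem : x ∈ U := hgUW τU ⟨hτU.1.le, hτU.2⟩
  have hyVmem : y ∈ V := hgVW τV ⟨hτV.1.le, hτV.2⟩
  -- (a) not separated by `A_`: the circle of radius `ρ'`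
  have hrank : 1 < Module.rank ℝ ℂ := by rw [Complex.rank_real_complex]; norm_num
  have hyA : y ∈ connectedComponentIn A_ᶜ x := by
    refine (isPreconnected_sphere hrank e ρ').subset_connectedComponentIn (mem_sphere.mpr hxU) ?_
      (mem_sphere.mpr hyV)
    intro z hz hzA
    have := hA_rad z hzA
    rw [mem_sphere.mp hz] at this
    linarith
  -- (b) not separated by `B_`: initial segments and the small disc
  have hsegU : IsPreconnected (gU '' Icc 0 τU) := isPreconnected_Icc.image _ hgUc.continuousOn
  have hsegV : IsPreconnected (gV '' Icc 0 τV) := isPreconnected_Icc.image _ hgVc.continuousOn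
  set W : Set ℂ := (gU '' Icc 0 τU ∪ ball e r₀') ∪ gV '' Icc 0 τV with hW
  have hWc : IsPreconnected W := by
    apply IsPreconnected.union (gV 0)
    · refine Or.inr (mem_ball.mpr (by linarith))
    · exact ⟨0, ⟨le_rfl, hτV.1.le⟩, rfl⟩
    · apply IsPreconnected.union (gU 0)
      · exact ⟨0, ⟨le_rfl, hτU.1.le⟩, rfl⟩
      · exact mem_ball.mpr (by linarith)
      · exact hsegU
      · exact (convex_ball e r₀').isPreconnected
    · exact hsegV
  have hWB : W ⊆ B_ᶜ := by
    intro z hz hzB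
    have hzrad := hB_rad z hzB
    rcases hz with (⟨t, ht, rfl⟩ | hz) | ⟨t, ht, rfl⟩
    · -- on the `U`-segment: inside `B̄(e, ρ')` and in `U`
      rcases hzB with hz2 | hzS
      · exact (hZ₂Z hz2).1 (Or.inl (hgUW t ⟨ht.1, ht.2.trans hτU.2⟩))
      · have := hgUle t ht; linarith [hzS.1]
    · have := mem_ball.mp hz
      have hmin : r₀' < min m₂ r₁ := lt_min hr₀'hi (by linarith)
      linarith
    · rcases hzB with hz2 | hzS
      · exact (hZ₂Z hz2).1 (Or.inr (hgVW t ⟨ht.1, ht.2.trans hτV.2⟩))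
      · have := hgVle t ht; linarith [hzS.1]
  have hxW : x ∈ W := Or.inl (Or.inl ⟨τU, ⟨hτU.1.le, le_rfl⟩, rfl⟩)
  have hyW : y ∈ W := Or.inr ⟨τV, ⟨hτV.1.le, le_rfl⟩, rfl⟩
  have hyB : y ∈ connectedComponentIn B_ᶜ x := hWc.subset_connectedComponentIn hxW hWB hyW
  -- (c) Janiszewski
  have hJ := janiszewski hAcpt hBcpt (by rw [hAB]; exact isPreconnected_empty) hyA hyB
  -- the component of `x` off `A_ ∪ B_` lies in `U`
  set Cx := connectedComponentIn (A_ ∪ B_)ᶜ x with hCx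
  have hCxc : IsPreconnected Cx := isPreconnected_connectedComponentIn
  have hCxsub : Cx ⊆ (A_ ∪ B_)ᶜ := connectedComponentIn_subset _ _
  have hxCx : x ∈ Cx := by
    refine mem_connectedComponentIn ?_
    intro h
    rcases h with h | h
    · have := hA_rad x h; rw [hxU] at this; linarith
    · have := hB_rad x h; rw [hxU] at this
      have : min m₂ r₁ ≤ ρ' := this
      -- `x ∈ B_` is impossible: `x ∈ U` rules out `Z₂`, radius rules out the shell
      rcases h with h2 | hS
      · exact (hZ₂Z h2).1 (Or.inl hxUmem)
      · linarith [hS.1]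
  -- radii on `Cx`: never in the shell, so always `< r₁` (IVT), and `> r₀`
  have hCxlt : ∀ z ∈ Cx, dist z e < r₁ := by
    intro z hz
    by_contra hge
    push Not at hge
    -- intermediate value between `x` (radius ρ' < r₁) and `z` (radius ≥ r₁): radius `r₁` is hit
    have hcont : ContinuousOn (fun w => dist w e) Cx := (continuous_id.dist continuous_const).continuousOn
    obtain ⟨w, hw, hwr⟩ := hCxc.intermediate_value hxCx hz hcont ⟨by rw [hxU]; exact hρ'r.le, hge⟩
    exact hCxsub hw (Or.inr (Or.inr ⟨by simp only at hwr; rw [hwr], by simp only at hwr; rw [hwr]; linarith⟩))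
  have hCxgt : ∀ z ∈ Cx, r₀ < dist z e := by
    intro z hz
    by_contra hle
    push Not at hle
    exact hCxsub hz (Or.inl (Or.inr (mem_closedBall.mpr hle)))
  have hCxUV : Cx ⊆ U ∪ V := by
    intro z hz
    by_contra hzG
    have hzZ : z ∈ Z := ⟨hzG, (hCxgt z hz).le, (hCxlt z hz).le⟩
    rw [← hZunion] at hzZ
    rcases hzZ with h1 | h2
    · exact hCxsub hz (Or.inl (Or.inl h1))
    · exact hCxsub hz (Or.inr (Or.inl h2))
  rcases hCxc.subset_or_subset hU hV hUV hCxUV with hCU | hCV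
  · exact Set.disjoint_left.mp hUV (hCU hJ) hyVmem
  · exact Set.disjoint_left.mp hUV hxUmem (hCV hxCx)

end Hochman2025

end Literature.Dynamics.SymbolicDynamics
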